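import Summits.SmoothPoincare4.SmoothPoincare4.Theorems.SymplecticOrigamiGromovRecognitionRelEndJointAux
import Summits.SmoothPoincare4.SmoothPoincare4.Theorems.SymplecticOrigamiGromovRecognitionRelEndLeafSwap
import Summits.SmoothPoincare4.SmoothPoincare4.Theorems.SymplecticOrigamiGromovRecognitionRelEndEmbeddedLocalImage
import Summits.SmoothPoincare4.SmoothPoincare4.Theorems.SymplecticOrigamiGromovRecognitionRelEndSignConstantOnLeaf
import Summits.SmoothPoincare4.SmoothPoincare4.Theorems.SymplecticOrigamiGromovRecognitionRelEndLocalIndexSigned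
import Literature.Geometry.Symplectic.PositivityOfIntersectionsLocal
import Literature.Topology.PlaneTopology.WindingNumber
import Mathlib

/-!
# The signed local index of a curve against an `H`-leaf, with the sign read at a reference point
(registered aux helper `helper_jointSignedIndex` of `helper_joint` (L9), line `cross-cap-laurent`,
crux `GromovRecognitionRelEnd`, item stmt-SmoothPoincare4-11009)

For an `H`-leaf `L' = (u', v')` with a normal witness `(N', π')` whose kernels are `JX`-invariant on
`N'`, a reference point `q ∈ K' := pairImage u' v'` with a preimage `ξq` of `1` under `dπ'_q`, and
`ε := +1` if `0 < Im (dπ'_q (JX ξq))` else `-1`: a smooth `JX`-holomorphic `p : ℂ → X` with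
`p z ∈ K'` is either locally inside `K'` near `z`, or meets `K'` isolatedly at `z` with
`ε · wind (π' ∘ p ∘ circleLoop z r) ≥ 1` for all small `r`, `= 1` iff `d(π' ∘ p)_z` is onto.
This is `helper_localIndexSigned` (positivity of intersections, applied at the affine point of
`(u', v')` or of the swapped pair `(v', u')` through which `p z` is presented, with the local image
property `helper_embeddedLocalImage`) combined with the constancy of the orientation sign along
`K'` (`helper_signConstantOnLeaf`) and its non-vanishing (`helper_orientationSign_basic`).
-/

noncomputable section

open scoped Manifold ContDiff Topology
open Set Function Filter Literature.Topology.FourManifolds Literature.Topology.FourManifolds.ComplexProjectiveSpace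
  Literature.Geometry.Symplectic Literature.Topology.PlaneTopology

-- the prescribed namespace `Summit.<P>.<Sub>.…` duplicates `SmoothPoincare4` (P = Sub)
set_option linter.dupNamespace false

namespace Summit.SmoothPoincare4.SmoothPoincare4.Theorems.GromovRecognitionRelEnd.CrossCapLaurent

/-- **Registered aux helper `helper_jointSignedIndex`** (see the module docstring). -/
theorem helper_jointSignedIndex : ∀ (X : Type) [TopologicalSpace X] [T2Space X]
    [SecondCountableTopology X] [ChartedSpace (EuclideanSpace ℝ (Fin 4)) X] [IsManifold (𝓡 4) ∞ X]
    (JX : AlmostComplexStructure (𝓡 4) ∞ X) (FH : C(ComplexProjectiveSpace 1, X)) (u' v' : ℂ → X)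
    (N' : Set X) (π' : X → ℂ) (q : X) (ξq : TangentSpace (𝓡 4) q) (p : ℂ → X) (z : ℂ),
    positivityOfIntersections_leafCoordinate → IsLeafOf (fun y => JX y) FH u' v' →
    IsNormalWitness N' π' u' v' →
    (∀ y ∈ N', ∀ ξ : TangentSpace (𝓡 4) y, mfderiv (𝓡 4) 𝓘(ℝ, ℂ) π' y ξ = 0 →
      mfderiv (𝓡 4) 𝓘(ℝ, ℂ) π' y (JX y ξ) = 0) →
    q ∈ pairImage u' v' → (show ℂ from mfderiv (𝓡 4) 𝓘(ℝ, ℂ) π' q ξq) = 1 →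
    ContMDiff 𝓘(ℝ, ℂ) (𝓡 4) ∞ p → IsJHolomorphic (𝓡 4) (fun y => JX y) p → p z ∈ pairImage u' v' →
    (∀ᶠ w in 𝓝 z, p w ∈ pairImage u' v') ∨
    (∃ r₀ : ℝ, 0 < r₀ ∧
      (∀ w : ℂ, 0 < ‖w - z‖ → ‖w - z‖ ≤ r₀ → p w ∈ N' ∧ p w ∉ pairImage u' v') ∧
      ∀ r : ℝ, 0 < r → r ≤ r₀ →
        1 ≤ (if 0 < (show ℂ from mfderiv (𝓡 4) 𝓘(ℝ, ℂ) π' q (JX q ξq)).im then (1 : ℤ) else -1) *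
            wind (fun t => π' (p (circleLoop z r t))) ∧
        ((if 0 < (show ℂ from mfderiv (𝓡 4) 𝓘(ℝ, ℂ) π' q (JX q ξq)).im then (1 : ℤ) else -1) *
            wind (fun t => π' (p (circleLoop z r t))) = 1 ↔
          Surjective (mfderiv 𝓘(ℝ, ℂ) 𝓘(ℝ, ℂ) (π' ∘ p) z))) := by
  intro X _ _ _ _ _ JX FH u' v' N' π' q ξq p z hF3 hl' hW hJinv hqK hξq hp hJp hpz
  set ε : ℤ := if 0 < (show ℂ from mfderiv (𝓡 4) 𝓘(ℝ, ℂ) π' q (JX q ξq)).im then 1 else -1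
    with hε
  have hK'sub : pairImage u' v' ⊆ N' := by rw [pairImage_eq]; exact hW.image_subset
  obtain ⟨hl's, himg'⟩ := helper_leaf_swap X (fun y => JX y) FH u' v' hl'
  have hW' : IsNormalWitness N' π' v' u' := Joint.isNormalWitness_swap hW himg'
  -- the meeting point as an affine point of `(a, b) = (u', v')` or of the swapped pair
  have main : ∀ (a b : ℂ → X) (z' : ℂ), TwoChartSphere (fun y => JX y) a b →
      IsEmbeddedPair a b → IsNormalWitness N' π' a b → pairImage a b = pairImage u' v' →
      p z = a z' →
      (∀ᶠ w in 𝓝 z, p w ∈ pairImage u' v') ∨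
      (∃ r₀ : ℝ, 0 < r₀ ∧
        (∀ w : ℂ, 0 < ‖w - z‖ → ‖w - z‖ ≤ r₀ → p w ∈ N' ∧ p w ∉ pairImage u' v') ∧
        ∀ r : ℝ, 0 < r → r ≤ r₀ →
          1 ≤ ε * wind (fun t => π' (p (circleLoop z r t))) ∧
          (ε * wind (fun t => π' (p (circleLoop z r t))) = 1 ↔
            Surjective (mfderiv 𝓘(ℝ, ℂ) 𝓘(ℝ, ℂ) (π' ∘ p) z))) := by
    intro a b z' hab hemb hWab himg hpt
    have hloc := helper_embeddedLocalImage X (fun y => JX y) a b z' hab hemb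
    have H := helper_localIndexSigned X JX hF3 p a b N' π' z z' hp hJp hab hemb hWab hJinv hloc
      hpt
    rw [himg] at H
    rcases H with H | ⟨r₀, hr₀, hpunct, Hsign⟩
    · exact Or.inl H
    refine Or.inr ⟨r₀, hr₀, hpunct, fun r hr hrr => ?_⟩
    have hyK : a z' ∈ pairImage u' v' := hpt ▸ hpz
    have hyN : a z' ∈ N' := hK'sub hyK
    obtain ⟨ξ', hξ'⟩ := hWab.submersive (a z') hyN (1 : ℂ)
    have hsame := helper_signConstantOnLeaf X JX u' v' N' π' hl'.sphere.smooth_u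
      hl'.sphere.smooth_v hl'.sphere.compat hW hJinv q hqK (a z') hyK ξq ξ' hξq hξ'
    have hne : (show ℂ from mfderiv (𝓡 4) 𝓘(ℝ, ℂ) π' (a z') (JX (a z') ξ')).im ≠ 0 :=
      (helper_orientationSign_basic (mfderiv (𝓡 4) 𝓘(ℝ, ℂ) π' (a z')) (JX (a z')) ξ' ξ'
        (fun w => JX.map_map (a z') w) (hWab.submersive _ hyN) (hJinv _ hyN) hξ' hξ').2
    by_cases hpos : 0 < (show ℂ from mfderiv (𝓡 4) 𝓘(ℝ, ℂ) π' q (JX q ξq)).im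
    · have hε1 : ε = 1 := by rw [hε, if_pos hpos]
      obtain ⟨h1, h2⟩ := (Hsign ξ' hξ').1 (hsame.1 hpos) r hr hrr
      rw [hε1, one_mul]
      exact ⟨h1, h2⟩
    · have hε1 : ε = -1 := by rw [hε, if_neg hpos]
      have hneg : (show ℂ from mfderiv (𝓡 4) 𝓘(ℝ, ℂ) π' (a z') (JX (a z') ξ')).im < 0 :=
        lt_of_le_of_ne (not_lt.mp fun h => hpos (hsame.2 h)) hne
      obtain ⟨h1, h2⟩ := (Hsign ξ' hξ').2 hneg r hr hrr
      rw [hε1]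
      refine ⟨by linarith, ?_⟩
      rw [← h2]
      constructor <;> intro h <;> linarith
  rcases (mem_pairImage_iff _ _ _).1 hpz with ⟨z', hz'⟩ | hpv
  · exact main u' v' z' hl'.sphere hl'.embedded hW rfl hz'.symm
  · exact main v' u' 0 hl's.sphere hl's.embedded hW' himg' hpv

end Summit.SmoothPoincare4.SmoothPoincare4.Theorems.GromovRecognitionRelEnd.CrossCapLaurent

end
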